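import Summits.QuantumFields.YangMills.Theorems.AlphaInputsT3ACv3StartSystemSepLoc
import HarnessLib

/-!
# `AlphaInputsT3ACv3StartSystemSep` — START v3.1 (S5)-4b, file 5: **THE (A4 = hsep) BINDER OF `StartAssembly.dist1_plaqHol_startU_le`** — two distinct tubes are never active on bonds
# of one constrained non-deep fine plaquette — generic (★★ `hsep_of_corners`) and for the canonical system (★★ `hsep_startSys`) — cell `ym3-torus`, width seat `ym-ust-19936-w5` (g2)

WHY ((S5)-4b OF RECORD; OWNER 03:48Z «(hsep): take it»).  Let tubes `Q`, `Q'` be active on bonds of a constrained non-deep `q`.  By ★w2 g2's (hbox) all four corners of `q` lie in BOTH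
tube boxes: `q.src = c_Q + u = c_{Q'} + u'`.  `…SepLoc` reads this per direction: transverse to both or longitudinal to both ⇒ same cell label; hence PARALLEL tubes (same `{μ, ν}`)
coincide — in `d = 3` every direction is transverse or the one longitudinal direction.  CROSSING tubes (`{μ,ν} ≠ {μ',ν'}`; in `d = 3` they share one direction `γ`, `Q` is longitudinal
in `β ∈ {μ',ν'}`, `Q'` in `α ∈ {μ,ν}`) pin `q` within `Rt` of the vertex site of the coarse vertex `y* = (Q.src on {μ,ν}, Q'.src elsewhere)` (`src_adj_of_mixed`: the labels in `α`, `β`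
are equal or adjacent toward `y*`).  Of the `2^3` cells at `y*`, those in `Q`'s `β`-layer are `Q`'s four cells and those in `Q'`'s `α`-layer are `Q'`'s; a remaining cell, if missing
from `Ω`, is the continuation AHEAD (or, after alignment v3.1 (i), BEHIND) of a cell of `Q` across the vertex, so the quadrant rule (clauses A∕B of `quadOf`) points `Q`'s profile at a
quadrant whose continuation across the vertex is missing — but the active bond's quadrant endpoint (`chart_of_tubeActive`, `chartPoint_cases`) forces that quadrant's `α`-label to be
`Q'`'s (★ `cellOf_eq_src_of_quadrant`), so the continuation is one of `Q'`'s cells, present: contradiction.  Hence `y*` is an INTERIOR vertex and `q`, charted within `Rt` of its vertex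
site, is deep (`deep_of_vertexChart`, radius `Rt + 1 = R_b`) — excluded.  So only `Q = Q'` remains.
WHAT.  §1 coordinate helpers; §2 ★ `cellOf_eq_src_of_quadrant`; §3 ★★ `hsep_of_corners` (generic: any rule `σ` with the two clauses, (hbox) as a hypothesis in ★w2's letters, the
ball side as `hVert` «a `C`-plaquette charted within `Rt` of an interior vertex site is deep»); §4 ★★ `hsep_startSys`: the instance at `quadOf`∕`rT`∕`RtT`∕`RbT`∕`FpOf`∕`IsBallΩ`∕`BallBond`,
(hbox) supplied by `hbox_startSys` and `hVert` by `deep_of_vertexChart` — so its displayed binders are EXACTLY those of `hbox_startSys` (`hTop`∕`hBot`, saturation, `16 ≤ L^k`,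
`4L^k ≤ N₀`, `N₀ = N_k·L^k`, the log window); conclusion literally the `hsep` binder of `…StartKnit.dist1_plaqHol_startSys_le`.
HONEST FRAMING.  Lattice bookkeeping; no analysis; def-free.  Count-neutral helper toward the (FL) row of 2′∕2′χ (`--supports stmt-QuantumFields-19936`); the ball hypotheses
`hTop`∕`hBot` remain the LEAD's; (FL)∕`hLift`, the stub, the crux and the gap are NOT claimed; registry untouched.  YM₃ on T³ is RUNG R3, not Clay.

References: T. Bałaban, Commun. Math. Phys. 102 (1985) 277–309 [Balaban1985Variational] ((11)–(14) pp.279–280); [Balaban1985UV3] Commun. Math. Phys. 102 (1985) 255–275 ((38)–(39) p.266).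
-/

set_option autoImplicit false

noncomputable section

open scoped Matrix.Norms.L2Operator

namespace Summit.QuantumFields.YangMills.Theorems.TubeStart

open Literature.MathematicalPhysics.QuantumFieldTheory.Balaban1983to89
open Literature.MathematicalPhysics.QuantumFieldTheory.Balaban1983to89.T4AdjointCovarianceUnitary (lieSU expSU)
open Literature.MathematicalPhysics.QuantumFieldTheory.Balaban1983to89.BlockAveragingSectionAction (iterSec)
open Literature.MathematicalPhysics.QuantumFieldTheory.Balaban1983to89.B10Eq38TorusDomains (toFine plaqsIn cornerSet mem_plaqsIn_iff)
open Summit.QuantumFields.Balaban3D.Carriers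
open Summit.QuantumFields.YangMills.Theorems.ModelBox
open Summit.QuantumFields.YangMills.Theorems.TubeProfile (betaQB betaQB_touches betaQB_window)

variable {P : Params} {k : ℕ}

/-! ## §1 Coordinate helpers -/

/-- Coordinates of a shifted site. [folklore] -/
theorem shift_apply_ite (x : Site P k) (μ j : Fin P.d) : (x.shift μ) j = x j + if j = μ then 1 else 0 := by
  simp only [Site.shift, Function.update_apply]
  split_ifs with h
  · subst h; rfl
  · rw [add_zero]

/-- Coordinates of an unshifted site. [folklore] -/
theorem unshift_apply_ite (x : Site P k) (μ j : Fin P.d) : (unshift x μ) j = x j - if j = μ then 1 else 0 := by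
  simp only [unshift, Function.update_apply]
  split_ifs with h
  · subst h; rfl
  · rw [sub_zero]

/-! ## §2 The quadrant of an active tube against the label of a crossing tube -/

/-- **★ QUADRANT CONSISTENCY**: if `Q` (transverse in `α`) is active on a bond of `q` with quadrant endpoint on the side `σQ`, and `Q'` (longitudinal in `α`) charts the corners of `q`, then
the `α`-label of the quadrant cell `cellOf Q σQ` is `Q'`'s `α`-label. [cite: Balaban1985Variational, (11)–(14) pp.279–280] -/
theorem cellOf_eq_src_of_quadrant {Rt : ℕ} {Q Q' : Plaq P k} {q : Plaq P 0} {u u' p : Fin P.d → ℤ} (σQ : Bool × Bool) {α : Fin P.d}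
    (hα : α = Q.μ ∨ α = Q.ν) (hα' : ¬ (α = Q'.μ ∨ α = Q'.ν))
    (hrel : (u α ≤ 0 ∧ u' α = u α + (P.L ^ k / 2 : ℕ) ∧ Q'.src α = Q.src α) ∨ (1 ≤ u α ∧ u' α = u α - (P.L ^ k / 2 : ℕ) - 1 ∧ Q'.src α = Q.src α + 1))
    (hpu : p α = u α ∨ (p α = u α + 1 ∧ (α = q.μ ∨ α = q.ν)))
    (hside : (if σQ.1 then p Q.μ ≤ 0 else 1 ≤ p Q.μ) ∧ (if σQ.2 then p Q.ν ≤ 0 else 1 ≤ p Q.ν))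
    (huμ' : InTube Q'.μ Q'.ν Rt (P.L ^ k / 2) (u' + e q.μ)) (huν' : InTube Q'.μ Q'.ν Rt (P.L ^ k / 2) (u' + e q.ν)) :
    cellOf Q σQ α = Q'.src α := by
  have hμν : Q.μ ≠ Q.ν := ne_of_lt Q.hμν
  -- no corner of `q` overflows the top of `Q'`'s box: `u'_α = h` with `α` a direction of `q` is impossible
  have hover : ¬ (u' α = (P.L ^ k / 2 : ℕ) ∧ (α = q.μ ∨ α = q.ν)) := by
    rintro ⟨hu'α, rfl | rfl⟩
    · have := huμ'.abs_le_of_not_mem hα'; rw [add_e_apply_same, abs_le] at this; omega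
    · have := huν'.abs_le_of_not_mem hα'; rw [add_e_apply_same, abs_le] at this; omega
  -- the side condition in direction `α`, as one Boolean
  obtain ⟨sα, hcell, hsd⟩ : ∃ sα : Bool, cellOf Q σQ α = Q.src α + (if sα = false then 1 else 0) ∧ (if sα then p α ≤ 0 else 1 ≤ p α) := by
    rw [cellOf_apply]
    rcases hα with rfl | rfl
    · refine ⟨σQ.1, ?_, hside.1⟩
      rw [if_neg (show ¬ (Q.μ = Q.ν ∧ σQ.2 = false) from fun h => hμν h.1), add_zero]
      by_cases h1 : σQ.1 = false
      · rw [if_pos (show Q.μ = Q.μ ∧ σQ.1 = false from ⟨rfl, h1⟩), if_pos h1]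
      · rw [if_neg (show ¬ (Q.μ = Q.μ ∧ σQ.1 = false) from fun h => h1 h.2), if_neg h1]
    · refine ⟨σQ.2, ?_, hside.2⟩
      rw [if_neg (show ¬ (Q.ν = Q.μ ∧ σQ.1 = false) from fun h => hμν h.1.symm), add_zero]
      by_cases h2 : σQ.2 = false
      · rw [if_pos (show Q.ν = Q.ν ∧ σQ.2 = false from ⟨rfl, h2⟩), if_pos h2]
      · rw [if_neg (show ¬ (Q.ν = Q.ν ∧ σQ.2 = false) from fun h => h2 h.2), if_neg h2]
  rw [hcell]
  cases sα
  · -- shifted side: `1 ≤ p_α`, so `1 ≤ u_α` (else the corner `q.src + e_α` overflows `Q'`'s box)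
    rw [if_neg Bool.false_ne_true] at hsd
    rw [if_pos rfl]
    rcases hrel with ⟨hu0, hu'α, -⟩ | ⟨-, -, h⟩
    · exfalso
      rcases hpu with h | ⟨h, hq⟩
      · omega
      · exact hover ⟨by omega, hq⟩
    · exact h.symm
  · -- unshifted side: `p_α ≤ 0`, so `u_α ≤ 0`
    rw [if_pos rfl] at hsd
    rw [if_neg (by decide : ¬ (true = false)), add_zero]
    rcases hrel with ⟨-, -, h⟩ | ⟨hu1, -, -⟩
    · exact h.symm
    · exfalso; rcases hpu with h | ⟨h, -⟩ <;> omega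

/-! ## §3 (A4 = hsep), generic -/

section Sep

variable {n : Type*} [Fintype n] [DecidableEq n] [Nonempty n]
variable (σ : Plaq P k → Bool × Bool) (r : ℕ) (V : GaugeField P k (Matrix.specialUnitaryGroup n ℂ)) (Rt : ℕ) (Fp : Plaq P k → lieSU n)
  (IsBall : Site P 0 → Prop) (InBall : Site P 0 → PBond P 0 → Prop) (C : Plaq P 0 → Prop)

/-- **★★ (A4 = hsep), GENERIC.**  Hypotheses: standing range `k + 1 ≤ m + K`; `Ω` saturated at level `k+1` (alignment); a unique longitudinal direction `λ` for every tube (`d = 3`); the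
rule `σ` has the two clauses of `quadOf`; radii `2Rt + 1 ≤ L^k`, `Rt + 2 ≤ L^k`, `2·max(Rt, ⌊L^k/2⌋) + 1 ≤ N₀`, `N₀ = N_k·L^k`; logarithms `expSU F′_Q =` the `V(∂Q)⁻¹`-word on the tubes;
(hbox) in ★w2 g2's letters (`hbox_of_corners`); ball hypothesis `hVert` (a `C`-plaquette charted within `Rt` of the vertex site of an INTERIOR vertex is deep).  Conclusion: the (A4)
binder for the forms `t_Q = s + β_{r,σ(Q)}` and `IsTube := (· ∈ plaqsIn k Ω)`. [cite: Balaban1985Variational, (11)–(14) pp.279–280] -/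
theorem hsep_of_corners (hk1 : k + 1 ≤ P.m + P.K) (Ω : Set (Site P 0)) (hsat1 : ∀ z z' : Site P k, blockOf z = blockOf z' → (CellIn Ω k z ↔ CellIn Ω k z'))
    (lam : Plaq P k → Fin P.d) (hlam : ∀ Q j, ¬ (j = Q.μ ∨ j = Q.ν) ↔ j = lam Q)
    (hσA : ∀ Q, (∃ s, MissingAhead Ω Q s) → MissingAhead Ω Q (σ Q))
    (hσB : ∀ Q, (¬ ∃ s, MissingAhead Ω Q s) → (∃ s, MissingBehind Ω Q s) → MissingBehind Ω Q (σ Q))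
    (hRt2 : 2 * Rt + 1 ≤ P.L ^ k) (hRt : Rt + 2 ≤ P.L ^ k) (hN : 2 * max Rt (P.L ^ k / 2) + 1 ≤ P.sitesPerDir 0) (hNk : P.sitesPerDir 0 = P.sitesPerDir k * P.L ^ k)
    (hF : ∀ Q : Plaq P k, Q ∈ plaqsIn k Ω → expSU (Fp Q) = V ⟨Q.src, Q.ν⟩ * V ⟨Q.src.shift Q.ν, Q.μ⟩ * (V ⟨Q.src.shift Q.μ, Q.ν⟩)⁻¹ * (V ⟨Q.src, Q.μ⟩)⁻¹)
    (hboxH : ∀ Q, Q ∈ plaqsIn k Ω → ∀ q, C q → ¬ Plaq.Deep IsBall InBall q →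
      (∃ b, Plaq.HasBond q b ∧ TubeActive V Rt Fp (fun Q => stringInd Q.μ Q.ν + betaQB r (σ Q).1 (σ Q).2 Q.μ Q.ν) (· ∈ plaqsIn k Ω) Q b) →
      ∃ u : Fin P.d → ℤ, q.src = boxSite (cornerSite k Q.src Q.μ Q.ν) u ∧ InTube Q.μ Q.ν Rt (P.L ^ k / 2) u ∧ InTube Q.μ Q.ν Rt (P.L ^ k / 2) (u + e q.μ) ∧
        InTube Q.μ Q.ν Rt (P.L ^ k / 2) (u + e q.ν) ∧ InTube Q.μ Q.ν Rt (P.L ^ k / 2) (u + e q.μ + e q.ν))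
    (hVert : ∀ (y : Site P k) (q : Plaq P 0), C q → IsInteriorVertex k Ω y → (∃ v, InBox Rt v ∧ q.src = boxSite (vertexSite k y) v) → Plaq.Deep IsBall InBall q) :
    ∀ Q Q' (q : Plaq P 0), C q → ¬ Plaq.Deep IsBall InBall q →
      (∃ b, Plaq.HasBond q b ∧ TubeActive V Rt Fp (fun Q => stringInd Q.μ Q.ν + betaQB r (σ Q).1 (σ Q).2 Q.μ Q.ν) (· ∈ plaqsIn k Ω) Q b) →
      (∃ b, Plaq.HasBond q b ∧ TubeActive V Rt Fp (fun Q => stringInd Q.μ Q.ν + betaQB r (σ Q).1 (σ Q).2 Q.μ Q.ν) (· ∈ plaqsIn k Ω) Q' b) → Q = Q' := by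
  have hk : k ≤ P.m + P.K := (Nat.le_succ k).trans hk1
  have hRtL : Rt + 1 ≤ P.L ^ k := by omega
  intro Q Q' q hCq hnd hA hA'
  obtain ⟨b, hqb, hact⟩ := hA
  obtain ⟨b', hqb', hact'⟩ := hA'
  have hQ : Q ∈ plaqsIn k Ω := hact.1
  have hQ' : Q' ∈ plaqsIn k Ω := hact'.1
  obtain ⟨u, hsrc, hu, huμ, huν, -⟩ := hboxH Q hQ q hCq hnd ⟨b, hqb, hact⟩
  obtain ⟨u', hsrc', hu', huμ', huν', -⟩ := hboxH Q' hQ' q hCq hnd ⟨b', hqb', hact'⟩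
  have hqq : boxSite (cornerSite k Q.src Q.μ Q.ν) u = boxSite (cornerSite k Q'.src Q'.μ Q'.ν) u' := hsrc.symm.trans hsrc'
  have hT : ∀ i, (i = Q.μ ∨ i = Q.ν) → (i = Q'.μ ∨ i = Q'.ν) → Q.src i = Q'.src i :=
    fun i hi hi' => src_eq_of_transverse hNk hu hu' hqq hRt2 hi hi'
  have hμν : Q.μ ≠ Q.ν := ne_of_lt Q.hμν
  have hμν' : Q'.μ ≠ Q'.ν := ne_of_lt Q'.hμν
  by_cases hpar : Q.μ = Q'.μ ∧ Q.ν = Q'.ν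
  · -- PARALLEL TUBES: every label agrees
    have hs : Q.src = Q'.src := by
      funext i
      by_cases hi : i = Q.μ ∨ i = Q.ν
      · exact hT i hi (by rw [← hpar.1, ← hpar.2]; exact hi)
      · exact src_eq_of_longitudinal hNk hu hu' hqq hi (by rw [← hpar.1, ← hpar.2]; exact hi)
    obtain ⟨y, μ, ν, h⟩ := Q
    obtain ⟨y', μ', ν', h'⟩ := Q'
    simp only at hs hpar
    obtain ⟨rfl, rfl⟩ := hpar
    subst hs
    rfl
  · -- CROSSING TUBES are impossible: `q` would be deep
    exfalso
    -- `β := lam Q` is transverse to `Q'`, `α := lam Q'` is transverse to `Q`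
    have cross : ∀ {A B : Plaq P k}, ¬ (A.μ = B.μ ∧ A.ν = B.ν) → lam A = B.μ ∨ lam A = B.ν := by
      intro A B hAB
      by_contra hno
      rw [not_or] at hno
      have h1 : B.μ = A.μ ∨ B.μ = A.ν := by by_contra h; exact hno.1 ((hlam A _).mp h).symm
      have h2 : B.ν = A.μ ∨ B.ν = A.ν := by by_contra h; exact hno.2 ((hlam A _).mp h).symm
      have hA := A.hμν
      have hB := B.hμν
      rcases h1 with h1 | h1 <;> rcases h2 with h2 | h2
      · exact absurd (h1.trans h2.symm) (ne_of_lt B.hμν)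
      · exact hAB ⟨h1.symm, h2.symm⟩
      · rw [h1, h2] at hB; exact lt_asymm hA hB
      · exact absurd (h1.trans h2.symm) (ne_of_lt B.hμν)
    have hβ' : lam Q = Q'.μ ∨ lam Q = Q'.ν := cross hpar
    have hβ : ¬ (lam Q = Q.μ ∨ lam Q = Q.ν) := (hlam Q _).mpr rfl
    have hα : lam Q' = Q.μ ∨ lam Q' = Q.ν := cross (fun h => hpar ⟨h.1.symm, h.2.symm⟩)
    have hα' : ¬ (lam Q' = Q'.μ ∨ lam Q' = Q'.ν) := (hlam Q' _).mpr rfl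
    have hofQ : ∀ j, ¬ (j = Q.μ ∨ j = Q.ν) → j = lam Q := fun j hj => (hlam Q j).mp hj
    have hofQ' : ∀ j, ¬ (j = Q'.μ ∨ j = Q'.ν) → j = lam Q' := fun j hj => (hlam Q' j).mp hj
    have hT' : ∀ j, ¬ (j = Q.μ ∨ j = Q.ν) → (j = Q'.μ ∨ j = Q'.ν) := fun j hj => by rw [hofQ j hj]; exact hβ'
    -- the mixed label relations in `α` and `β`
    have hαrel := src_adj_of_mixed hNk hu hu' hqq hRtL hα hα'
    have hβrel := src_adj_of_mixed hNk hu' hu hqq.symm hRtL hβ' hβ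
    -- the quadrant endpoint of `Q`'s active bond and the quadrant consistency in `α`
    obtain ⟨w, hwT, -, hbw, -, -, -, p, hp, hside⟩ := chart_of_tubeActive σ r V Rt Fp hk hRt hN (hF Q hQ) hact
    have hpu := chartPoint_cases hN hsrc hu huμ huν hqb hbw hwT hp (lam Q')
    have hquad : cellOf Q (σ Q) (lam Q') = Q'.src (lam Q') := cellOf_eq_src_of_quadrant (σ Q) hα hα' hαrel hpu hside huμ' huν'
    -- the vertex `y*`
    obtain ⟨y, hyT, hyL⟩ : ∃ y : Site P k, (∀ i, (i = Q.μ ∨ i = Q.ν) → y i = Q.src i) ∧ (∀ i, ¬ (i = Q.μ ∨ i = Q.ν) → y i = Q'.src i) := by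
      classical
      exact ⟨fun i => if i = Q.μ ∨ i = Q.ν then Q.src i else Q'.src i, fun i hi => if_pos hi, fun i hi => if_neg hi⟩
    have hyT' : ∀ i, (i = Q'.μ ∨ i = Q'.ν) → y i = Q'.src i := fun i hi => by
      by_cases h : i = Q.μ ∨ i = Q.ν
      · rw [hyT i h]; exact hT i h hi
      · exact hyL i h
    -- `q.src` charted within `Rt` of the vertex site of `y*`
    have hv : ∃ v, InBox Rt v ∧ q.src = boxSite (vertexSite k y) v := by
      classical
      refine ⟨fun i => if i = Q.μ ∨ i = Q.ν then u i else u' i, fun i => ?_, funext fun i => ?_⟩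
      · by_cases h : i = Q.μ ∨ i = Q.ν
        · simp only [if_pos h]; exact hu.abs_le_of_mem h
        · simp only [if_neg h]; exact hu'.abs_le_of_mem (hT' i h)
      · by_cases h : i = Q.μ ∨ i = Q.ν
        · have hc := congrFun hsrc i
          simp only [boxSite, cornerSite_apply_of_mem k _ h] at hc
          simp only [boxSite, vertexSite_apply_two_mul_half, if_pos h, hyT i h]
          exact hc
        · have hc := congrFun hsrc' i
          simp only [boxSite, cornerSite_apply_of_mem k _ (hT' i h)] at hc
          simp only [boxSite, vertexSite_apply_two_mul_half, if_neg h, hyL i h]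
          exact hc
    -- the vertex is interior
    have hβμ : lam Q ≠ Q.μ := fun h => hβ (Or.inl h)
    have hβν : lam Q ≠ Q.ν := fun h => hβ (Or.inr h)
    have hint : IsInteriorVertex k Ω y := by
      intro f
      -- cells in `Q`'s `β`-layer are `Q`'s
      by_cases hA : Q.src (lam Q) = y (lam Q) + (if f (lam Q) then 1 else 0)
      · have hcell : shiftBy y f = cellOf Q (!f Q.μ, !f Q.ν) := by
          funext j
          rw [shiftBy_apply, cellOf_not_apply]
          by_cases hj : j = Q.μ ∨ j = Q.ν
          · rw [hyT j hj]; by_cases hf : f j = true <;> simp [hj, hf]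
          · rw [hofQ j hj, hA, if_neg (show ¬ ((lam Q = Q.μ ∨ lam Q = Q.ν) ∧ f (lam Q) = true) from fun h => hβ h.1), add_zero]
        rw [hcell]; exact cellIn_cellOf hQ _
      -- cells in `Q'`'s `α`-layer are `Q'`'s
      by_cases hB : Q'.src (lam Q') = y (lam Q') + (if f (lam Q') then 1 else 0)
      · have hcell : shiftBy y f = cellOf Q' (!f Q'.μ, !f Q'.ν) := by
          funext j
          rw [shiftBy_apply, cellOf_not_apply]
          by_cases hj : j = Q'.μ ∨ j = Q'.ν
          · rw [hyT' j hj]; by_cases hf : f j = true <;> simp [hj, hf]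
          · rw [hofQ' j hj, hB, if_neg (show ¬ ((lam Q' = Q'.μ ∨ lam Q' = Q'.ν) ∧ f (lam Q') = true) from fun h => hα' h.1), add_zero]
        rw [hcell]; exact cellIn_cellOf hQ' _
      -- a contested cell: present, by the quadrant rule for `Q`
      by_contra hmiss
      rw [hyL _ hβ] at hA
      -- `Q'`'s cells with the `σ(Q)`-pattern on the shared direction and pattern `t` in `β`
      obtain ⟨g, hg⟩ : ∃ g : Bool → Fin P.d → Bool, ∀ t i, g t i = if i = lam Q then t else if i = Q.μ then !(σ Q).1 else !(σ Q).2 := ⟨_, fun _ _ => rfl⟩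
      have hcellσ : ∀ t j, j ≠ lam Q → cellOf Q (σ Q) j = cellOf Q' (!(g t) Q'.μ, !(g t) Q'.ν) j := by
        intro t j hj
        rw [cellOf_not_apply Q' (g t) j]
        by_cases hj' : j = Q'.μ ∨ j = Q'.ν
        · have hjQ : j = Q.μ ∨ j = Q.ν := by by_contra h; exact hj (hofQ j h)
          rw [cellOf_apply, hT j hjQ hj', hg]
          have h1 : Q.μ ≠ lam Q := fun h => hβμ h.symm
          have h2 : Q.ν ≠ lam Q := fun h => hβν h.symm
          rcases hjQ with rfl | rfl
          · simp [hμν, h1, hj']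
          · simp [hμν.symm, h2, hj']
        · rw [hofQ' j hj'] at hj ⊢
          rw [hquad, if_neg (fun h => hα' h.1), add_zero]
      have hcellβ : ∀ t, cellOf Q' (!(g t) Q'.μ, !(g t) Q'.ν) (lam Q) = Q'.src (lam Q) + (if t = true then 1 else 0) := by
        intro t
        rw [cellOf_not_apply Q' (g t), hg, if_pos rfl]
        simp [hβ']
      -- the cell `C` of `Q` under the contested cell, and the contested cell's shared coordinates
      have hsC : CellIn Ω k (cellOf Q (!f Q.μ, !f Q.ν)) := cellIn_cellOf hQ _
      have hzT : ∀ j, j ≠ lam Q → shiftBy y f j = cellOf Q (!f Q.μ, !f Q.ν) j := by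
        intro j hj
        have hjQ : j = Q.μ ∨ j = Q.ν := by by_contra h; exact hj (hofQ j h)
        rw [shiftBy_apply, cellOf_not_apply, hyT j hjQ]
        by_cases hf : f j = true <;> simp [hjQ, hf]
      rcases hβrel with ⟨-, -, hββ⟩ | ⟨-, -, hββ⟩
      · -- `Q.src β = Q'.src β`: the contested cell is the continuation of `C` AHEAD across the vertex
        have hfβ : f (lam Q) = true := by
          by_contra hf
          apply hA
          rw [hββ]; simp [hf]
        have hz : shiftBy y f = (cellOf Q (!f Q.μ, !f Q.ν)).shift (lam Q) := by
          funext j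
          rw [shift_apply_ite]
          by_cases hj : j = lam Q
          · rw [hj, if_pos rfl, shiftBy_apply, cellOf_apply_of_not_mem Q _ hβ, hyL _ hβ, hfβ, if_pos rfl, hββ]
          · rw [if_neg hj, add_zero]; exact hzT j hj
        have hMA : ∃ s, MissingAhead Ω Q s := ⟨(!f Q.μ, !f Q.ν), lam Q, hβμ, hβν, by rw [← hz]; exact hmiss⟩
        obtain ⟨i, hiμ, hiν, hmissσ⟩ := hσA Q hMA
        have hi : i = lam Q := hofQ i (not_or.mpr ⟨hiμ, hiν⟩)
        rw [hi] at hmissσ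
        apply hmissσ
        have hz' : (cellOf Q (σ Q)).shift (lam Q) = cellOf Q' (!(g true) Q'.μ, !(g true) Q'.ν) := by
          funext j
          rw [shift_apply_ite]
          by_cases hj : j = lam Q
          · rw [hj, if_pos rfl, hcellβ, cellOf_apply_of_not_mem Q _ hβ, hββ, if_pos rfl]
          · rw [if_neg hj, add_zero]; exact hcellσ true j hj
        rw [hz']
        exact cellIn_cellOf hQ' _
      · -- `Q.src β = Q'.src β + 1`: the contested cell is the continuation of `C` BEHIND across the vertex
        have hfβ : f (lam Q) = false := by
          by_contra hf
          apply hA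
          rw [hββ]; simp [hf]
        have hz : shiftBy y f = unshift (cellOf Q (!f Q.μ, !f Q.ν)) (lam Q) := by
          funext j
          rw [unshift_apply_ite]
          by_cases hj : j = lam Q
          · rw [hj, if_pos rfl, shiftBy_apply, cellOf_apply_of_not_mem Q _ hβ, hyL _ hβ, hfβ, hββ, if_neg Bool.false_ne_true]; ring
          · rw [if_neg hj, sub_zero]; exact hzT j hj
        -- alignment v3.1 (i): `C ∈ Ω` with `C − e_β ∉ Ω` forces every cell of `Q` to continue AHEAD, so clause B of the rule applies
        have hnoA : ¬ ∃ s, MissingAhead Ω Q s := by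
          rintro ⟨s, i, hiμ, hiν, hmissA⟩
          have hi : i = lam Q := hofQ i (not_or.mpr ⟨hiμ, hiν⟩)
          rw [hi] at hmissA
          exact hmissA (cellIn_shift_of_not_cellIn_unshift Ω hk1 hsat1 hsC (by rw [← hz]; exact hmiss)
            (by rw [cellOf_apply_of_not_mem Q _ hβ, cellOf_apply_of_not_mem Q _ hβ]) (cellIn_cellOf hQ s))
        have hMB : ∃ s, MissingBehind Ω Q s := ⟨(!f Q.μ, !f Q.ν), lam Q, hβμ, hβν, by rw [← hz]; exact hmiss⟩
        obtain ⟨i, hiμ, hiν, hmissσ⟩ := hσB Q hnoA hMB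
        have hi : i = lam Q := hofQ i (not_or.mpr ⟨hiμ, hiν⟩)
        rw [hi] at hmissσ
        apply hmissσ
        have hz' : unshift (cellOf Q (σ Q)) (lam Q) = cellOf Q' (!(g false) Q'.μ, !(g false) Q'.ν) := by
          funext j
          rw [unshift_apply_ite]
          by_cases hj : j = lam Q
          · rw [hj, if_pos rfl, hcellβ, cellOf_apply_of_not_mem Q _ hβ, hββ, if_neg Bool.false_ne_true]; ring
          · rw [if_neg hj, sub_zero]; exact hcellσ false j hj
        rw [hz']
        exact cellIn_cellOf hQ' _
    exact hnd (hVert y q hCq hint hv)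

/-! ## §4 (A4 = hsep) for the canonical system -/

/-- **★★ (A4 = hsep) FOR THE CANONICAL SYSTEM** of `…v3StartSystem` (`tfOf k Ω`, `IsTubeΩ k Ω`, `FpOf k V`, `RtT`, balls `IsBallΩ k Ω` of radius `RbT`; rule `quadOf Ω`): (hbox) is
★w2 g2's `hbox_startSys`, the ball side is `deep_of_vertexChart` (`RbT = RtT + 1`), so the displayed binders are exactly those of `hbox_startSys` — region binders `16 ≤ L^k`,
`4·L^k ≤ N₀`, `N₀ = N_k·L^k`, saturation at levels `k`, `k+1`; the log window on the tubes; `hTop`∕`hBot` at radius `RtT`.  Conclusion: literally the `hsep` binder of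
`…StartKnit.dist1_plaqHol_startSys_le`. [cite: Balaban1985Variational, (11)–(14) pp.279–280] -/
theorem hsep_startSys (hk1 : k + 1 ≤ P.m + P.K) (Ω : Set (Site P 0)) (hsat : ∀ x x' : Site P 0, coarsen k x = coarsen k x' → (x ∈ Ω ↔ x' ∈ Ω))
    (htf : ∀ z : Site P k, coarsen k (toFine k z) = z) (hsat1 : ∀ z z' : Site P k, blockOf z = blockOf z' → (CellIn Ω k z ↔ CellIn Ω k z'))
    (lam : Plaq P k → Fin P.d) (hlam : ∀ Q j, ¬ (j = Q.μ ∨ j = Q.ν) ↔ j = lam Q)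
    (hL : 16 ≤ P.L ^ k) (hN : 4 * P.L ^ k ≤ P.sitesPerDir 0) (hNk : P.sitesPerDir 0 = P.sitesPerDir k * P.L ^ k)
    (hwin : ∀ Q : Plaq P k, Q ∈ plaqsIn k Ω → ‖((wordQ k V Q : Matrix.specialUnitaryGroup n ℂ) : Matrix n n ℂ) - 1‖ ≤ 1 / 4 ∧
      (Fintype.card n : ℝ) * ‖((wordQ k V Q : Matrix.specialUnitaryGroup n ℂ) : Matrix n n ℂ) - 1‖ < Real.pi)
    (hTop : ∀ Q : Plaq P k, Q ∈ plaqsIn k Ω → (∀ s, CellIn Ω k ((cellOf Q s).shift (lam Q))) → ∀ q : Plaq P 0, q ∈ plaqsIn 0 Ω →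
      (∃ u, InTube Q.μ Q.ν (RtT P k) (P.L ^ k / 2) u ∧ u (lam Q) = (P.L ^ k / 2 : ℕ) ∧ q.src = boxSite (cornerSite k Q.src Q.μ Q.ν) u ∧ (q.μ = lam Q ∨ q.ν = lam Q)) →
      Plaq.Deep (IsBallΩ k Ω) (fun v b => BallBond v (RbT P k) b) q)
    (hBot : ∀ Q : Plaq P k, Q ∈ plaqsIn k Ω → (∀ s, CellIn Ω k (unshift (cellOf Q s) (lam Q))) → ∀ q : Plaq P 0, q ∈ plaqsIn 0 Ω →
      (∃ u, InTube Q.μ Q.ν (RtT P k) (P.L ^ k / 2) u ∧ u (lam Q) = -((P.L ^ k / 2 : ℕ) : ℤ) ∧ q.src.shift (lam Q) = boxSite (cornerSite k Q.src Q.μ Q.ν) u ∧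
        (q.μ = lam Q ∨ q.ν = lam Q)) → Plaq.Deep (IsBallΩ k Ω) (fun v b => BallBond v (RbT P k) b) q) :
    ∀ Q Q' (q : Plaq P 0), q ∈ plaqsIn 0 Ω → ¬ Plaq.Deep (IsBallΩ k Ω) (fun v b => BallBond v (RbT P k) b) q →
      (∃ b, Plaq.HasBond q b ∧ TubeActive V (RtT P k) (FpOf k V) (tfOf k Ω) (IsTubeΩ k Ω) Q b) →
      (∃ b, Plaq.HasBond q b ∧ TubeActive V (RtT P k) (FpOf k V) (tfOf k Ω) (IsTubeΩ k Ω) Q' b) → Q = Q' := by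
  have hRt2 : 2 * RtT P k + 1 ≤ P.L ^ k := by unfold RtT rT; omega
  have hRt : RtT P k + 2 ≤ P.L ^ k := by unfold RtT rT; omega
  have hN' : 2 * max (RtT P k) (P.L ^ k / 2) + 1 ≤ P.sitesPerDir 0 := by
    have : max (RtT P k) (P.L ^ k / 2) ≤ P.L ^ k / 2 := max_le (by unfold RtT rT; omega) le_rfl
    omega
  have hF : ∀ Q : Plaq P k, Q ∈ plaqsIn k Ω → expSU (FpOf k V Q) = V ⟨Q.src, Q.ν⟩ * V ⟨Q.src.shift Q.ν, Q.μ⟩ * (V ⟨Q.src.shift Q.μ, Q.ν⟩)⁻¹ * (V ⟨Q.src, Q.μ⟩)⁻¹ :=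
    fun Q hQ => expSU_FpOf k V Q (hwin Q hQ)
  have hbl : RtT P k + 1 ≤ RbT P k := (RtT_succ P k).le
  exact hsep_of_corners (fun Q => quadOf Ω Q) (rT P k) V (RtT P k) (FpOf k V) (IsBallΩ k Ω) (fun v b => BallBond v (RbT P k) b) (fun q => q ∈ plaqsIn 0 Ω) hk1 Ω hsat1
    lam hlam (fun Q h => missingAhead_quadOf Ω h) (fun Q h h' => missingBehind_quadOf Ω h h') hRt2 hRt hN' hNk hF
    (hbox_startSys V (IsBallΩ k Ω) (fun v b => BallBond v (RbT P k) b) (fun q => q ∈ plaqsIn 0 Ω) hk1 Ω hsat htf hsat1 (fun q h => h) lam hlam hL hN hwin hTop hBot)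
    (fun y q _ hy hv => by obtain ⟨v, hv, hq⟩ := hv; exact deep_of_vertexChart hbl Ω hy hv hq)

end Sep

end Summit.QuantumFields.YangMills.Theorems.TubeStart

end
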